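import Literature.NumberTheory.DiophantineGeometry.DetOrbitSymKroneckerBound
import Literature.RepresentationTheory.FiniteGroups.SymmetricGroupSquareEvaluation
import HarnessLib

/-!
# The rectangular symmetric Kronecker coefficient over `ℂ`, evaluated in the kernel

Bridge between `DetOrbitSymKroneckerBound.lean` (the rectangular symmetric Kronecker coefficient
`symKroneckerCoeffRect k m d λ = sk(λ, m × d)` of BLMW 2011 (5.2.5) with the PROVED character
formula `2·(md)!·sk = ∑_τ χ^λ(τ)(χ^□(τ)² + χ^□(τ²))` and the PROVED orbit-closure bound
`mult_{λ*} k[Δ(det_m)] ≤ sk(λ, m × d)`, BLMW Prop. 5.2.1 (5.2.7)) and the verified Murnaghan–Nakayama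
evaluator of `Literature/RepresentationTheory/FiniteGroups/SymmetricGroupSquareEvaluation.lean`
(`MNEval.skSumT`, `MNEval.sum_symSq_eq_skSumT`: over `ℂ`,
`∑_σ χ^λ(σ)(χ^μ(σ)² + χ^μ(σ²)) = skSumT n λᵗ.sortedParts μ.sortedParts`):

* `two_mul_factorial_mul_symKroneckerCoeffRect_eq_skSumT`:
  `2·(md)!·sk(λ, m × d) = skSumT (md) λᵗ (d^m)` in `ℤ`;
* `symKroneckerCoeffRect_eq_of_skSumT_eq`: from explicit lists `Lt = λᵗ.sortedParts`,
  `M = (d^m).sortedParts` (`= List.replicate m d` for `d ≠ 0`, `Nat.Partition.sortedParts_rectangle`)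
  and a kernel computation `skSumT (md) Lt M = 2·(md)!·s` (`decide`), `sk(λ, m × d) = s`;
* `orbitMultiplicity_det_le_of_skSumT_eq`: in the same situation `mult_{λ*} ℂ[Δ(det_m)] ≤ s`.

So a det-side value `s = sk(λ, m × d)` of a multiplicity-obstruction certificate is CHECKED by the
kernel (feasible for `md ≲ 20` in one `decide`; larger degrees need the class sum split, as for
`MNEval.kronSum`). The transpose list `Lt` of an explicit shape is obtained from
`sortedParts_transpose_ofColumns_eq` (`Literature/Barriers/ValiantsHypothesis/GCTMatrixPoweringSkEval.lean`,
shapes given by columns) or `transpose_rectangle_parts` (`OccurrenceObstructionsIP.lean`); this file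
imports neither. No new definitions, no named facts.

## References

* P. Bürgisser, J. M. Landsberg, L. Manivel, J. Weyman, SIAM J. Comput. 40(4) (2011), §5.2 (5.2.5),
  Prop. 5.2.1 (5.2.7). [cite: BLMW2011, §5.2 Prop. 5.2.1]
* W. Fulton, J. Harris, *Representation Theory*, GTM 129, §2.1 Exercise 2.2, Exercise 4.51
  (characters of `Sym²`, class sums). [cite: FultonHarrisGTM129, §2.1 Exercise 2.2]
-/

namespace Literature.NumberTheory.DiophantineGeometry

open Literature.RepresentationTheory.FiniteGroups.MNEval (skSumT sum_symSq_eq_skSumT)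

section Eval

variable {m d : ℕ}

/-- **`2·(md)!·sk(λ, m × d) = skSumT (md) λᵗ (d^m)`** over `ℂ` (`ℓ(λ) ≤ m²`): the character formula
`two_mul_factorial_mul_symKroneckerCoeffRect` evaluated by the class equation
`MNEval.sum_symSq_eq_skSumT`. [cite: FultonHarrisGTM129, §2.1 Exercise 2.2] -/
theorem two_mul_factorial_mul_symKroneckerCoeffRect_eq_skSumT (lam : Nat.Partition (m * d))
    (hlam : lam.parts.card ≤ m * m) :
    ((2 * (m * d).factorial * symKroneckerCoeffRect ℂ m d lam : ℕ) : ℤ) =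
      skSumT (m * d) lam.transpose.sortedParts (Nat.Partition.rectangle m d).sortedParts := by
  have h := two_mul_factorial_mul_symKroneckerCoeffRect ℂ lam hlam
  rw [sum_symSq_eq_skSumT] at h
  exact_mod_cast h

/-- **The value of `sk(λ, m × d)` from a kernel computation**: with explicit lists
`Lt = λᵗ.sortedParts`, `M = (d^m).sortedParts` and `skSumT (md) Lt M = 2·(md)!·s` (by `decide`),
`symKroneckerCoeffRect ℂ m d λ = s`. [cite: BLMW2011, §5.2 (5.2.5)] -/
theorem symKroneckerCoeffRect_eq_of_skSumT_eq (lam : Nat.Partition (m * d))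
    (hlam : lam.parts.card ≤ m * m) {Lt M : List ℕ} (hLt : lam.transpose.sortedParts = Lt)
    (hM : (Nat.Partition.rectangle m d).sortedParts = M) {s : ℕ}
    (h : skSumT (m * d) Lt M = 2 * (m * d).factorial * s) :
    symKroneckerCoeffRect ℂ m d lam = s := by
  have h1 := two_mul_factorial_mul_symKroneckerCoeffRect_eq_skSumT lam hlam
  rw [hLt, hM, h] at h1
  have h2 : 2 * (m * d).factorial * symKroneckerCoeffRect ℂ m d lam = 2 * (m * d).factorial * s := by
    exact_mod_cast h1
  exact Nat.eq_of_mul_eq_mul_left (Nat.mul_pos two_pos (Nat.factorial_pos _)) h2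

/-- **The orbit-closure bound, evaluated**: in the situation of
`symKroneckerCoeffRect_eq_of_skSumT_eq`, `mult_{λ*} ℂ[Δ(det_m)] ≤ s` (BLMW 2011 Prop. 5.2.1
(5.2.7) with the kernel value of `sk`). [cite: BLMW2011, §5.2 Prop. 5.2.1] -/
theorem orbitMultiplicity_det_le_of_skSumT_eq (lam : Nat.Partition (m * d))
    (hlam : lam.parts.card ≤ m * m) {Lt M : List ℕ} (hLt : lam.transpose.sortedParts = Lt)
    (hM : (Nat.Partition.rectangle m d).sortedParts = M) {s : ℕ}
    (h : skSumT (m * d) Lt M = 2 * (m * d).factorial * s) :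
    orbitMultiplicity ℂ (detFormLex ℂ m) m (Weight.dualOfPartition (m * m) lam).toMatIdx ≤ s := by
  rw [← symKroneckerCoeffRect_eq_of_skSumT_eq lam hlam hLt hM h]
  exact orbitMultiplicity_det_le_symKroneckerCoeffRect ℂ m lam hlam

end Eval

end Literature.NumberTheory.DiophantineGeometry
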